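import Mathlib
import HarnessLib
import Summits.Ventures.LatticeQCDFlow.Scoring.AgreementTestLocalPower
import Summits.Ventures.LatticeQCDFlow.Scoring.SimultaneousAgreementTwoSigma

/-!
# THE SHIFTED-BALL PROBABILITY `κ ↦ N^{⊗ι}{(z_{r₁} + κ)² + Σ_{r ≠ r₀, r₁} z_r² ≤ c}` IS EVEN,
# NON-INCREASING ON `[0, ∞)`, BOUNDED BY ITS ONE-DIMENSIONAL MARGINAL `N(κ,1)([−√c, √c])`, AND
# TENDS TO `0` AS `κ → ∞` (textbook: the non-central `χ²_{k−1}(κ²)` distribution function decreases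
# in the non-centrality; the POWER of the `k`-arm homogeneity test increases with the discrepancy)

HONEST FRAMING: exact (Metropolis-corrected) sampling algorithms for lattice gauge theory;
figures of merit are autocorrelation/cost numbers at stated couplings and volumes; no
continuum-physics claim.

Venture `LatticeQCDFlow` (cell pub-lqcd), topic `Scoring`; FANOUT row 4 (`s0-u1-b`, GEN-34).
NEW WORK of the cell (classical), no definition, nothing cited as a fact (the non-central `χ²` law
and Anderson's inequality are NAMED ONLY).

WHY (row 4).  `Scoring/GaussianNoncentralCochranReduction` (GEN-34) shows that the law of the
`k`-arm inverse-variance homogeneity statistic of independent `N(μ_i, σ_i²)` arm estimates is the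
law of the SHIFTED BALL functional `(z_{r₁} + κ)² + Σ_{r ≠ r₀, r₁} z_r²` under `N(0,1)^{⊗ι}`, with
`κ² = Σ_i (μ_i − μ̄_w)²/σ_i²`; the chain-level local-power theorem transports it to `R` independent
codes whose centres differ by `O(1/√n)`.  What makes that a statement about POWER is this file:
the probability of the acceptance event `{· ≤ c}` is an even function of `κ`, NON-INCREASING in
`κ ≥ 0` (a larger true discrepancy is detected at least as often), bounded by the one-dimensional
window probability `N(κ,1)([−√c, √c])` of `Scoring/AgreementTestLocalPower`, and tends to `0` as
`κ → ∞` (consistent with the power-one theorem `Scoring/KArmHomogeneityPower`).  Device: integrate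
out the `r₁`-th coordinate first (Mathlib's `lmarginal`, `lintegral_le_of_lmarginal_le`), where the
section probability is the one-dimensional `N(0,1){t | (t + κ)² ≤ ρ} = N(κ,1)([−√ρ, √ρ])`, whose
monotonicity in `κ ≥ 0` is a derivative computation on the primitive of the Gaussian density
(`Scoring/SimultaneousAgreementTwoSigma`).

## Content

* §1 (one dimension) `gaussianReal_real_sqShift_le` (`N(0,1){t | (t+κ)² ≤ ρ} = N(κ,1)([−√ρ, √ρ])`
  for `ρ ≥ 0`, `= 0` for `ρ < 0`), `gaussianReal_real_Icc_symm_neg` (even in the centre),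
  `hasDerivAt_gaussianReal_real_Icc_shift`, **`antitoneOn_gaussianReal_real_Icc_symm`** (`δ ↦
  N(δ,1)([−z, z])` is non-increasing on `[0, ∞)` for `z ≥ 0`), `antitoneOn_gaussianReal_sqShift`.
* §2 (the shifted ball, any finite index type) `lmarginal_shiftedBall_singleton` (the
  `r₁`-section of `{(z_{r₁} + κ)² + Σ_{r ≠ r₀, r₁} z_r² ∈ T}` is `N(0,1){t | (t+κ)² + Σ… ∈ T}`),
  **`pi_gaussianReal_shiftedBall_levelSet_eq_zero`** (level sets are null — continuity sets),
  **`pi_gaussianReal_shiftedBall_mono`** / **`pi_gaussianReal_shiftedBall_antitoneOn`**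
  (non-increasing in `κ ≥ 0`), `pi_gaussianReal_shiftedBall_neg` (even),
  **`pi_gaussianReal_shiftedBall_le_marginal`** (`≤ N(0,1){t | (t+κ)² ≤ c}`),
  **`tendsto_pi_gaussianReal_shiftedBall_atTop`** (`→ 0`),
  `pi_gaussianReal_shiftedBall_fin_two` (two arms: `= N(κ,1)([−√c, √c])`, `c ≥ 0`).

NOT CLAIMED: strict decrease, continuity in `κ`, Anderson's inequality for general convex sets,
densities or numerical values, anything chain-level (separate file).
-/

open MeasureTheory ProbabilityTheory Filter Topology Finset
open scoped ENNReal

namespace Summit.Ventures.LatticeQCDFlow.Scoring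

open Set

/-! ## §1 One dimension: `N(0,1){t | (t + κ)² ≤ ρ}` -/

section OneDim

/-- For `ρ < 0` the event `{(t + κ)² ≤ ρ}` is empty. -/
theorem setOf_sqShift_le_of_neg {κ ρ : ℝ} (hρ : ρ < 0) : {t : ℝ | (t + κ) ^ 2 ≤ ρ} = ∅ := by
  ext t
  simp only [Set.mem_setOf_eq, Set.mem_empty_iff_false, iff_false, not_le]
  exact hρ.trans_le (sq_nonneg _)

/-- For `ρ ≥ 0`, `{t | (t + κ)² ≤ ρ} = (· + κ)⁻¹' [−√ρ, √ρ]`. -/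
theorem setOf_sqShift_le_eq_preimage {κ ρ : ℝ} (hρ : 0 ≤ ρ) :
    {t : ℝ | (t + κ) ^ 2 ≤ ρ} = (fun t => t + κ) ⁻¹' Icc (-Real.sqrt ρ) (Real.sqrt ρ) := by
  ext t
  simp only [Set.mem_setOf_eq, Set.mem_preimage, Set.mem_Icc]
  constructor
  · intro h
    have h' : (t + κ) ^ 2 ≤ Real.sqrt ρ ^ 2 := by rwa [Real.sq_sqrt hρ]
    exact abs_le.1 (abs_le_of_sq_le_sq h' (Real.sqrt_nonneg ρ))
  · rintro ⟨h1, h2⟩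
    calc (t + κ) ^ 2 ≤ Real.sqrt ρ ^ 2 := sq_le_sq' h1 h2
      _ = ρ := Real.sq_sqrt hρ

/-- The event `{(t + κ)² ≤ ρ}` is measurable. -/
theorem measurableSet_sqShift_le (κ ρ : ℝ) : MeasurableSet {t : ℝ | (t + κ) ^ 2 ≤ ρ} :=
  measurableSet_le (by fun_prop) measurable_const

/-- **`N(0,1){t | (t + κ)² ≤ ρ} = N(κ,1)([−√ρ, √ρ])`** for `ρ ≥ 0`. [ours] -/
theorem gaussianReal_sqShift_le_eq {κ ρ : ℝ} (hρ : 0 ≤ ρ) :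
    (gaussianReal 0 1) {t : ℝ | (t + κ) ^ 2 ≤ ρ}
      = (gaussianReal κ 1) (Icc (-Real.sqrt ρ) (Real.sqrt ρ)) := by
  have h := gaussianReal_map_add_const (μ := 0) (v := 1) κ
  rw [zero_add] at h
  rw [setOf_sqShift_le_eq_preimage hρ, ← h, Measure.map_apply (measurable_add_const κ) measurableSet_Icc]

/-- Real-valued form, all `ρ`: `N(0,1){(t + κ)² ≤ ρ} = N(κ,1)([−√ρ, √ρ])` if `0 ≤ ρ`, else `0`. -/
theorem gaussianReal_real_sqShift_le (κ ρ : ℝ) :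
    (gaussianReal 0 1).real {t : ℝ | (t + κ) ^ 2 ≤ ρ}
      = if 0 ≤ ρ then (gaussianReal κ 1).real (Icc (-Real.sqrt ρ) (Real.sqrt ρ)) else 0 := by
  split_ifs with hρ
  · rw [measureReal_def, measureReal_def, gaussianReal_sqShift_le_eq hρ]
  · rw [setOf_sqShift_le_of_neg (not_le.1 hρ), measureReal_empty]

/-- **Even in the centre**: `N(−δ,1)([−z, z]) = N(δ,1)([−z, z])`. [folklore] -/
theorem gaussianReal_real_Icc_symm_neg (δ z : ℝ) :
    (gaussianReal (-δ) 1).real (Icc (-z) z) = (gaussianReal δ 1).real (Icc (-z) z) := by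
  have h := gaussianReal_map_neg (μ := δ) (v := 1)
  rw [measureReal_def, measureReal_def, ← h, Measure.map_apply measurable_neg measurableSet_Icc]
  congr 2
  ext x
  simp only [Set.mem_preimage, Set.mem_Icc]
  constructor <;> rintro ⟨h1, h2⟩ <;> constructor <;> linarith

/-- `N(0,1)([a, b]) = F(b) − F(a)` for `a ≤ b`, `F(u) = ∫₀ᵘ φ`. [folklore] -/
theorem gaussianReal_real_Icc_eq_primitive_sub {a b : ℝ} (hab : a ≤ b) :
    (gaussianReal 0 1).real (Icc a b)
      = (∫ x in (0 : ℝ)..b, gaussianPDFReal 0 1 x) - ∫ x in (0 : ℝ)..a, gaussianPDFReal 0 1 x := by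
  rw [measureReal_def, gaussianReal_apply_eq_integral 0 one_ne_zero,
    ENNReal.toReal_ofReal (setIntegral_nonneg measurableSet_Icc fun x _ => gaussianPDFReal_nonneg _ _ _),
    integral_Icc_eq_integral_Ioc, ← intervalIntegral.integral_of_le hab,
    intervalIntegral.integral_interval_sub_left
      (CardConsistency.continuous_gaussianPDFReal_std.intervalIntegrable _ _)
      (CardConsistency.continuous_gaussianPDFReal_std.intervalIntegrable _ _)]

/-- The derivative of `δ ↦ N(δ,1)([−z, z]) = F(z − δ) − F(−z − δ)` is `φ(−z − δ) − φ(z − δ)`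
(`z ≥ 0`). [ours] -/
theorem hasDerivAt_gaussianReal_real_Icc_symm {z : ℝ} (hz : 0 ≤ z) (δ : ℝ) :
    HasDerivAt (fun δ : ℝ => (gaussianReal δ 1).real (Icc (-z) z))
      (gaussianPDFReal 0 1 (-z - δ) - gaussianPDFReal 0 1 (z - δ)) δ := by
  have hrepr : (fun δ : ℝ => (gaussianReal δ 1).real (Icc (-z) z))
      = fun δ => (∫ x in (0 : ℝ)..(z - δ), gaussianPDFReal 0 1 x)
          - ∫ x in (0 : ℝ)..(-z - δ), gaussianPDFReal 0 1 x := by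
    funext δ
    rw [CardConsistency.gaussianReal_real_Icc_shift, gaussianReal_real_Icc_eq_primitive_sub (by linarith)]
  rw [hrepr]
  have h1 : HasDerivAt (fun δ : ℝ => ∫ x in (0 : ℝ)..(z - δ), gaussianPDFReal 0 1 x)
      (gaussianPDFReal 0 1 (z - δ) * (-1)) δ := by
    have hi : HasDerivAt (fun δ : ℝ => z - δ) (-1) δ := by
      simpa using (hasDerivAt_id δ).const_sub z
    exact (CardConsistency.hasDerivAt_primitive_gaussianPDFReal (z - δ)).comp δ hi
  have h2 : HasDerivAt (fun δ : ℝ => ∫ x in (0 : ℝ)..(-z - δ), gaussianPDFReal 0 1 x)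
      (gaussianPDFReal 0 1 (-z - δ) * (-1)) δ := by
    have hi : HasDerivAt (fun δ : ℝ => -z - δ) (-1) δ := by
      simpa using (hasDerivAt_id δ).const_sub (-z)
    exact (CardConsistency.hasDerivAt_primitive_gaussianPDFReal (-z - δ)).comp δ hi
  exact (h1.sub h2).congr_deriv (by ring)

/-- For `z, δ ≥ 0`: `φ(−z − δ) ≤ φ(z − δ)` (the standard Gaussian density is even and decreasing in
`|x|`, and `|z − δ| ≤ z + δ`). -/
theorem gaussianPDFReal_neg_sub_le {z δ : ℝ} (hz : 0 ≤ z) (hδ : 0 ≤ δ) :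
    gaussianPDFReal 0 1 (-z - δ) ≤ gaussianPDFReal 0 1 (z - δ) := by
  rw [CardConsistency.gaussianPDFReal_std_eq, CardConsistency.gaussianPDFReal_std_eq]
  refine mul_le_mul_of_nonneg_left (Real.exp_le_exp.2 ?_) (by positivity)
  have : (z - δ) ^ 2 ≤ (-z - δ) ^ 2 := by nlinarith
  linarith

/-- **`δ ↦ N(δ,1)([−z, z])` IS NON-INCREASING ON `[0, ∞)`** (`z ≥ 0`): a larger true discrepancy
passes the symmetric window at most as often. [ours] -/
theorem antitoneOn_gaussianReal_real_Icc_symm {z : ℝ} (hz : 0 ≤ z) :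
    AntitoneOn (fun δ : ℝ => (gaussianReal δ 1).real (Icc (-z) z)) (Ici 0) := by
  have hderiv := hasDerivAt_gaussianReal_real_Icc_symm hz
  refine antitoneOn_of_deriv_nonpos (convex_Ici 0)
    (fun δ _ => (hderiv δ).continuousAt.continuousWithinAt)
    (fun δ _ => (hderiv δ).differentiableAt.differentiableWithinAt) ?_
  intro δ hδ
  rw [interior_Ici, Set.mem_Ioi] at hδ
  rw [(hderiv δ).deriv]
  have := gaussianPDFReal_neg_sub_le hz hδ.le
  linarith

/-- **`κ ↦ N(0,1){t | (t + κ)² ≤ ρ}` is non-increasing on `[0, ∞)`** (every `ρ`). [ours] -/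
theorem antitoneOn_gaussianReal_sqShift (ρ : ℝ) :
    AntitoneOn (fun κ : ℝ => (gaussianReal 0 1).real {t : ℝ | (t + κ) ^ 2 ≤ ρ}) (Ici 0) := by
  intro κ hκ κ' hκ' hle
  simp only [gaussianReal_real_sqShift_le]
  split_ifs with hρ
  · exact antitoneOn_gaussianReal_real_Icc_symm (Real.sqrt_nonneg ρ) hκ hκ' hle
  · exact le_rfl

/-- The same in `ℝ≥0∞`. -/
theorem gaussianReal_sqShift_le_mono {κ κ' : ℝ} (hκ : 0 ≤ κ) (hle : κ ≤ κ') (ρ : ℝ) :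
    (gaussianReal 0 1) {t : ℝ | (t + κ') ^ 2 ≤ ρ} ≤ (gaussianReal 0 1) {t : ℝ | (t + κ) ^ 2 ≤ ρ} := by
  have h := antitoneOn_gaussianReal_sqShift ρ (mem_Ici.2 hκ) (mem_Ici.2 (hκ.trans hle)) hle
  simp only [measureReal_def] at h
  exact (ENNReal.toReal_le_toReal (measure_ne_top _ _) (measure_ne_top _ _)).1 h

/-- Evenness in one dimension: `N(0,1){(t − κ)² ≤ ρ} = N(0,1){(t + κ)² ≤ ρ}`. -/
theorem gaussianReal_sqShift_neg (κ ρ : ℝ) :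
    (gaussianReal 0 1) {t : ℝ | (t + -κ) ^ 2 ≤ ρ} = (gaussianReal 0 1) {t : ℝ | (t + κ) ^ 2 ≤ ρ} := by
  rcases lt_or_ge ρ 0 with hρ | hρ
  · rw [setOf_sqShift_le_of_neg hρ, setOf_sqShift_le_of_neg hρ]
  · rw [gaussianReal_sqShift_le_eq hρ, gaussianReal_sqShift_le_eq hρ]
    have h := gaussianReal_real_Icc_symm_neg κ (Real.sqrt ρ)
    simp only [measureReal_def] at h
    exact (ENNReal.toReal_eq_toReal_iff' (measure_ne_top _ _) (measure_ne_top _ _)).1 h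

end OneDim

/-! ## §2 The shifted ball under `N(0,1)^{⊗ι}` -/

section Ball

variable {ι : Type*} [Fintype ι] [DecidableEq ι]

/-- The shifted-ball event is measurable. -/
theorem measurableSet_shiftedBall (r₀ r₁ : ι) (κ c : ℝ) :
    MeasurableSet {z : ι → ℝ | (z r₁ + κ) ^ 2 + ∑ r ∈ (univ.erase r₀).erase r₁, z r ^ 2 ≤ c} :=
  measurableSet_le (by fun_prop) measurable_const

/-- The generalised shifted-ball event `{(z_{r₁} + κ)² + Σ_{r ≠ r₀, r₁} z_r² ∈ T}` is measurable
for Borel `T`. -/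
theorem measurableSet_shiftedBall_mem (r₀ r₁ : ι) (κ : ℝ) {T : Set ℝ} (hT : MeasurableSet T) :
    MeasurableSet {z : ι → ℝ | (z r₁ + κ) ^ 2 + ∑ r ∈ (univ.erase r₀).erase r₁, z r ^ 2 ∈ T} :=
  (by fun_prop : Measurable fun z : ι → ℝ =>
    (z r₁ + κ) ^ 2 + ∑ r ∈ (univ.erase r₀).erase r₁, z r ^ 2) hT

/-- **The `r₁`-section**: integrating out the `r₁`-th coordinate of the indicator of
`{(z_{r₁} + κ)² + Σ_{r ≠ r₀, r₁} z_r² ∈ T}` gives the one-dimensional probability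
`N(0,1){t | (t + κ)² + Σ_{r ≠ r₀, r₁} x_r² ∈ T}`. [ours] -/
theorem lmarginal_shiftedBall_singleton {r₀ r₁ : ι} (κ : ℝ) {T : Set ℝ} (hT : MeasurableSet T)
    (x : ι → ℝ) :
    (∫⋯∫⁻_{r₁}, ({z : ι → ℝ | (z r₁ + κ) ^ 2 + ∑ r ∈ (univ.erase r₀).erase r₁, z r ^ 2 ∈ T}).indicator 1
        ∂fun _ : ι => gaussianReal 0 1) x
      = (gaussianReal 0 1) {t : ℝ | (t + κ) ^ 2 + ∑ r ∈ (univ.erase r₀).erase r₁, x r ^ 2 ∈ T} := by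
  rw [lmarginal_singleton]
  simp only
  have hset : ∀ t : ℝ, ({z : ι → ℝ | (z r₁ + κ) ^ 2 + ∑ r ∈ (univ.erase r₀).erase r₁, z r ^ 2 ∈ T}).indicator
        (1 : (ι → ℝ) → ℝ≥0∞) (Function.update x r₁ t)
      = ({t : ℝ | (t + κ) ^ 2 + ∑ r ∈ (univ.erase r₀).erase r₁, x r ^ 2 ∈ T}).indicator 1 t := by
    intro t
    have hsum : ∑ r ∈ (univ.erase r₀).erase r₁, (Function.update x r₁ t) r ^ 2
        = ∑ r ∈ (univ.erase r₀).erase r₁, x r ^ 2 := by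
      refine Finset.sum_congr rfl fun r hr => ?_
      rw [Function.update_of_ne (Finset.mem_erase.1 hr).1]
    have hmem : Function.update x r₁ t
          ∈ {z : ι → ℝ | (z r₁ + κ) ^ 2 + ∑ r ∈ (univ.erase r₀).erase r₁, z r ^ 2 ∈ T}
        ↔ t ∈ {t : ℝ | (t + κ) ^ 2 + ∑ r ∈ (univ.erase r₀).erase r₁, x r ^ 2 ∈ T} := by
      simp only [Set.mem_setOf_eq, Function.update_self, hsum]
    by_cases ht : t ∈ {t : ℝ | (t + κ) ^ 2 + ∑ r ∈ (univ.erase r₀).erase r₁, x r ^ 2 ∈ T}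
    · rw [indicator_of_mem (hmem.2 ht), indicator_of_mem ht]
      rfl
    · rw [indicator_of_notMem (mt hmem.1 ht), indicator_of_notMem ht]
  simp_rw [hset]
  rw [lintegral_indicator_one]
  exact (by fun_prop : Measurable fun t : ℝ =>
    (t + κ) ^ 2 + ∑ r ∈ (univ.erase r₀).erase r₁, x r ^ 2) hT

/-- The `≤ c` section is the one-dimensional event with the shifted threshold:
`{t | (t + κ)² + C ≤ c} = {t | (t + κ)² ≤ c − C}`. -/
theorem setOf_sqShift_add_le (κ C c : ℝ) :
    {t : ℝ | (t + κ) ^ 2 + C ≤ c} = {t : ℝ | (t + κ) ^ 2 ≤ c - C} := by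
  ext t
  simp only [Set.mem_setOf_eq]
  constructor <;> intro h <;> linarith

/-- **The level sets of the shifted ball are Gaussian-null**: for every `κ`, `c`,
`N^{⊗ι}{(z_{r₁} + κ)² + Σ_{r ≠ r₀, r₁} z_r² = c} = 0` (each `r₁`-section has at most two points;
`N(0,1)` has no atoms) — the continuity-set input for portmanteau. [ours] -/
theorem pi_gaussianReal_shiftedBall_levelSet_eq_zero (r₀ r₁ : ι) (κ c : ℝ) :
    (Measure.pi fun _ : ι => gaussianReal 0 1)
        {z : ι → ℝ | (z r₁ + κ) ^ 2 + ∑ r ∈ (univ.erase r₀).erase r₁, z r ^ 2 = c} = 0 := by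
  haveI : NullSingletonClass (gaussianReal (0 : ℝ) 1) := nullSingletonClass_gaussianReal one_ne_zero
  have hA := measurableSet_shiftedBall_mem r₀ r₁ κ (measurableSet_singleton c)
  simp only [Set.mem_singleton_iff] at hA
  rw [← lintegral_indicator_one hA, ← lintegral_zero (μ := Measure.pi fun _ : ι => gaussianReal 0 1)]
  refine lintegral_eq_of_lmarginal_eq {r₁} (measurable_one.indicator hA) measurable_const ?_
  funext x
  have h := lmarginal_shiftedBall_singleton (r₀ := r₀) (r₁ := r₁) κ (measurableSet_singleton c) x
  simp only [Set.mem_singleton_iff] at h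
  rw [h]
  have h0 : (∫⋯∫⁻_{r₁}, (fun _ => (0 : ℝ≥0∞)) ∂fun _ : ι => gaussianReal 0 1) x = 0 := by
    rw [lmarginal_singleton]
    simp
  rw [h0]
  set C := ∑ r ∈ (univ.erase r₀).erase r₁, x r ^ 2
  have hsub : {t : ℝ | (t + κ) ^ 2 + C = c} ⊆ {Real.sqrt (c - C) - κ, -Real.sqrt (c - C) - κ} := by
    intro t ht
    simp only [Set.mem_setOf_eq] at ht
    have ht2 : (t + κ) ^ 2 = c - C := by linarith
    have h' : |t + κ| = Real.sqrt (c - C) := by rw [← Real.sqrt_sq_eq_abs, ht2]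
    rcases abs_eq (Real.sqrt_nonneg _) |>.1 h' with h1 | h1
    · exact Or.inl (by linarith)
    · exact Or.inr (Set.mem_singleton_iff.2 (by linarith))
  exact measure_mono_null hsub ((Set.toFinite _).measure_zero _)

open scoped ENNReal in
/-- **THE SHIFTED-BALL PROBABILITY IS NON-INCREASING IN `κ ≥ 0`**: for `0 ≤ κ ≤ κ'` and every `c`,
`N^{⊗ι}{(z_{r₁} + κ')² + Σ_{r ≠ r₀, r₁} z_r² ≤ c} ≤ N^{⊗ι}{(z_{r₁} + κ)² + Σ_{r ≠ r₀, r₁} z_r² ≤ c}`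
(textbook: the non-central `χ²` distribution function decreases in the non-centrality). [ours] -/
theorem pi_gaussianReal_shiftedBall_mono {r₀ r₁ : ι} {κ κ' : ℝ} (hκ : 0 ≤ κ) (hle : κ ≤ κ') (c : ℝ) :
    (Measure.pi fun _ : ι => gaussianReal 0 1)
        {z : ι → ℝ | (z r₁ + κ') ^ 2 + ∑ r ∈ (univ.erase r₀).erase r₁, z r ^ 2 ≤ c}
      ≤ (Measure.pi fun _ : ι => gaussianReal 0 1)
        {z : ι → ℝ | (z r₁ + κ) ^ 2 + ∑ r ∈ (univ.erase r₀).erase r₁, z r ^ 2 ≤ c} := by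
  rw [← lintegral_indicator_one (measurableSet_shiftedBall r₀ r₁ κ' c),
    ← lintegral_indicator_one (measurableSet_shiftedBall r₀ r₁ κ c)]
  refine lintegral_le_of_lmarginal_le {r₁}
    ((measurable_one.indicator (measurableSet_shiftedBall r₀ r₁ κ' c)))
    ((measurable_one.indicator (measurableSet_shiftedBall r₀ r₁ κ c))) ?_
  intro x
  have h1 := lmarginal_shiftedBall_singleton (r₀ := r₀) (r₁ := r₁) κ' (measurableSet_Iic (a := c)) x
  have h2 := lmarginal_shiftedBall_singleton (r₀ := r₀) (r₁ := r₁) κ (measurableSet_Iic (a := c)) x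
  simp only [Set.mem_Iic] at h1 h2
  rw [h1, h2, setOf_sqShift_add_le, setOf_sqShift_add_le]
  exact gaussianReal_sqShift_le_mono hκ hle _

/-- Real-valued form: `κ ↦ N^{⊗ι}{(z_{r₁} + κ)² + Σ_{r ≠ r₀, r₁} z_r² ≤ c}` is `AntitoneOn [0, ∞)`. -/
theorem pi_gaussianReal_shiftedBall_antitoneOn (r₀ r₁ : ι) (c : ℝ) :
    AntitoneOn (fun κ : ℝ => (Measure.pi fun _ : ι => gaussianReal 0 1).real
      {z : ι → ℝ | (z r₁ + κ) ^ 2 + ∑ r ∈ (univ.erase r₀).erase r₁, z r ^ 2 ≤ c}) (Ici 0) := by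
  intro κ hκ κ' _ hle
  simp only [measureReal_def]
  exact (ENNReal.toReal_le_toReal (measure_ne_top _ _) (measure_ne_top _ _)).2
    (pi_gaussianReal_shiftedBall_mono (mem_Ici.1 hκ) hle c)

/-- **Even in `κ`**: the shifted-ball probability at `−κ` equals the one at `κ`. [ours] -/
theorem pi_gaussianReal_shiftedBall_neg (r₀ r₁ : ι) (κ c : ℝ) :
    (Measure.pi fun _ : ι => gaussianReal 0 1)
        {z : ι → ℝ | (z r₁ + -κ) ^ 2 + ∑ r ∈ (univ.erase r₀).erase r₁, z r ^ 2 ≤ c}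
      = (Measure.pi fun _ : ι => gaussianReal 0 1)
        {z : ι → ℝ | (z r₁ + κ) ^ 2 + ∑ r ∈ (univ.erase r₀).erase r₁, z r ^ 2 ≤ c} := by
  rw [← lintegral_indicator_one (measurableSet_shiftedBall r₀ r₁ (-κ) c),
    ← lintegral_indicator_one (measurableSet_shiftedBall r₀ r₁ κ c)]
  refine lintegral_eq_of_lmarginal_eq {r₁}
    ((measurable_one.indicator (measurableSet_shiftedBall r₀ r₁ (-κ) c)))
    ((measurable_one.indicator (measurableSet_shiftedBall r₀ r₁ κ c))) ?_
  funext x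
  have h1 := lmarginal_shiftedBall_singleton (r₀ := r₀) (r₁ := r₁) (-κ) (measurableSet_Iic (a := c)) x
  have h2 := lmarginal_shiftedBall_singleton (r₀ := r₀) (r₁ := r₁) κ (measurableSet_Iic (a := c)) x
  simp only [Set.mem_Iic] at h1 h2
  rw [h1, h2, setOf_sqShift_add_le, setOf_sqShift_add_le]
  exact gaussianReal_sqShift_neg κ _

/-- **The one-dimensional marginal bound**: `N^{⊗ι}{(z_{r₁} + κ)² + Σ_{r ≠ r₀, r₁} z_r² ≤ c}
≤ N(0,1){t | (t + κ)² ≤ c}`. [ours] -/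
theorem pi_gaussianReal_shiftedBall_le_marginal (r₀ r₁ : ι) (κ c : ℝ) :
    (Measure.pi fun _ : ι => gaussianReal 0 1)
        {z : ι → ℝ | (z r₁ + κ) ^ 2 + ∑ r ∈ (univ.erase r₀).erase r₁, z r ^ 2 ≤ c}
      ≤ (gaussianReal 0 1) {t : ℝ | (t + κ) ^ 2 ≤ c} := by
  have hsub : {z : ι → ℝ | (z r₁ + κ) ^ 2 + ∑ r ∈ (univ.erase r₀).erase r₁, z r ^ 2 ≤ c}
      ⊆ (fun z : ι → ℝ => z r₁) ⁻¹' {t : ℝ | (t + κ) ^ 2 ≤ c} := by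
    intro z hz
    simp only [Set.mem_setOf_eq, Set.mem_preimage] at hz ⊢
    have : 0 ≤ ∑ r ∈ (univ.erase r₀).erase r₁, z r ^ 2 := Finset.sum_nonneg fun r _ => sq_nonneg _
    linarith
  refine (measure_mono hsub).trans_eq ?_
  rw [← Measure.map_apply (measurable_pi_apply r₁) (measurableSet_sqShift_le κ c),
    (measurePreserving_eval (fun _ : ι => gaussianReal 0 1) r₁).map_eq]

/-- **THE SHIFTED-BALL PROBABILITY TENDS TO `0` AS `κ → ∞`** (every `c`). [ours] -/
theorem tendsto_pi_gaussianReal_shiftedBall_atTop (r₀ r₁ : ι) (c : ℝ) :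
    Tendsto (fun κ : ℝ => (Measure.pi fun _ : ι => gaussianReal 0 1).real
      {z : ι → ℝ | (z r₁ + κ) ^ 2 + ∑ r ∈ (univ.erase r₀).erase r₁, z r ^ 2 ≤ c}) atTop (𝓝 0) := by
  have hbound : ∀ κ : ℝ, (Measure.pi fun _ : ι => gaussianReal 0 1).real
        {z : ι → ℝ | (z r₁ + κ) ^ 2 + ∑ r ∈ (univ.erase r₀).erase r₁, z r ^ 2 ≤ c}
      ≤ (gaussianReal 0 1).real {t : ℝ | (t + κ) ^ 2 ≤ c} := fun κ => by
    simp only [measureReal_def]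
    exact (ENNReal.toReal_le_toReal (measure_ne_top _ _) (measure_ne_top _ _)).2
      (pi_gaussianReal_shiftedBall_le_marginal r₀ r₁ κ c)
  have hlim : Tendsto (fun κ : ℝ => (gaussianReal 0 1).real {t : ℝ | (t + κ) ^ 2 ≤ c}) atTop (𝓝 0) := by
    rcases lt_or_ge c 0 with hc | hc
    · simp only [setOf_sqShift_le_of_neg hc, measureReal_empty]
      exact tendsto_const_nhds
    · simp only [gaussianReal_real_sqShift_le, if_pos hc]
      have h := CardConsistency.tendsto_gaussianReal_real_Icc_atTop (Real.sqrt c)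
      exact h
  exact tendsto_of_tendsto_of_tendsto_of_le_of_le tendsto_const_nhds hlim
    (fun κ => measureReal_nonneg) hbound

end Ball

/-! ## §3 Two arms -/

section TwoArms

/-- **Two arms** (`ι = Fin 2`, `r₀ = 0`, `r₁ = 1`): the shifted ball is the one-dimensional window,
`N^{⊗2}{(z_1 + κ)² ≤ c} = N(κ,1)([−√c, √c])` for `c ≥ 0` — the local-power functional of
`Scoring/AgreementTestLocalPower` with `z = √c`, `δ = κ`. [ours] -/
theorem pi_gaussianReal_shiftedBall_fin_two {κ c : ℝ} (hc : 0 ≤ c) :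
    (Measure.pi fun _ : Fin 2 => gaussianReal 0 1).real
        {z : Fin 2 → ℝ | (z 1 + κ) ^ 2 + ∑ r ∈ (univ.erase 0).erase 1, z r ^ 2 ≤ c}
      = (gaussianReal κ 1).real (Icc (-Real.sqrt c) (Real.sqrt c)) := by
  have hE : ((univ : Finset (Fin 2)).erase 0).erase 1 = ∅ := by decide
  have hset : {z : Fin 2 → ℝ | (z 1 + κ) ^ 2 + ∑ r ∈ (univ.erase 0).erase 1, z r ^ 2 ≤ c}
      = (fun z : Fin 2 → ℝ => z 1) ⁻¹' {t : ℝ | (t + κ) ^ 2 ≤ c} := by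
    ext z
    simp only [hE, Finset.sum_empty, add_zero, Set.mem_setOf_eq, Set.mem_preimage]
  rw [measureReal_def, measureReal_def, hset,
    ← Measure.map_apply (measurable_pi_apply 1) (measurableSet_sqShift_le κ c),
    (measurePreserving_eval (fun _ : Fin 2 => gaussianReal 0 1) 1).map_eq,
    gaussianReal_sqShift_le_eq hc]

end TwoArms

end Summit.Ventures.LatticeQCDFlow.Scoring
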